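import Summits.BirchSwinnertonDyer.Rank1Residual.X11a.ChainNamedFacts
import Summits.BirchSwinnertonDyer.Rank1Residual.GaloisImage.MultiplicativeLargeImage
import HarnessLib

/-!
# Class X11a at `p ≥ 11`: `BSD(E,p)` from NAMED published facts + the per-pair `μ`-certificate,
# with NO hypothesis on the image of `ρ̄_{E,p}` (the `Surj` binder of x11a's chain is discharged)

HONEST FRAMING (cell `b2b-bsdres-*`, run/shared/lean/b2b/bsd-rank1-residual/, verbatim): the goal
of the cell is to DELETE the COMBINATION-SHAPED residual classes for ALL analytic-rank `≤ 1` elliptic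
curves over `ℚ` — "full BSD formula for every rank `≤ 1` curve in class C" assembled STRICTLY from
published theorems — so that the rank-`≤ 1` remainder becomes exactly the CONSTRUCTION-SHAPED
classes, which are TYPED (missing-input Props), NOT attempted; this is not "finishing BSD".
Filed by the x11c seat (gen 7) FOR the x11a seat's chain (`X11a/ChainNamedFacts.lean`,
`forall_bsdp_of_namedFacts`: X11a ∩ {`p ≥ 5`, `ρ̄_{E,p}` onto} ⟹ `BSD(E,p)` ⇐ named facts +
`MuAnZeroAt`).  Theorems only; no definition, no named fact; NO label change (X11a stays as
labelled by the lead/referee; the class-level residue is still Greenberg's `μ`-conjecture, typed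
`X11a.MuAnZeroAt`).

* `forall_bsdp_of_namedFacts_of_eleven_le` — the same chain with `5 ≤ p → Surj W p →` replaced by
  `11 ≤ p →`: on `ClassX11a` (`Mult ∧ Irr`) surjectivity at `p ≥ 11` is the theorem
  `ClassX11a.surj_of_eleven_le` (Serre 1972 §1.12 + Props. 14/15/17 and the named fact
  `BalakrishnanEtAl2019.thm12_not_le_normalizer_splitCartan` = BDMTV 2019 Thm. 1.2 /
  Bilu–Parent–Rebolledo 2013 Cor. 1.2, binder `hB`).  So X11a's "non-surjective leaf" needs no
  separate treatment at `p ≥ 11`: it is empty there; it lives at `p ∈ {5, 7}`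
  (`GaloisImage.eq_five_or_eq_seven_of_mult_of_irr_of_not_surj`).

## References

* [BalakrishnanEtAl2019] Balakrishnan–Dogra–Müller–Tuitman–Vonk, Ann. of Math. 189 (2019), Thm. 1.2.
* [SerreInventiones1972] J.-P. Serre, Invent. Math. 15 (1972), §1.12, §2.7.
* The chain's own sources as cited in `X11a/ChainNamedFacts.lean` (EPW 2006, Wan 2015,
  Stein–Wuthrich 2013, Wuthrich 2014, Hida, MTT, Greenberg–Stevens, GZK, modularity).
-/

noncomputable section

open scoped Classical

open WeierstrassCurve Literature.NumberTheory.EllipticCurves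
  Literature.NumberTheory.EllipticCurves.ModularForms
  Literature.NumberTheory.EllipticCurves.Rank1Residual
  Literature.NumberTheory.EllipticCurves.Rank1Residual.Typed
  Literature.NumberTheory.EllipticCurves.Wuthrich2014
  Literature.NumberTheory.EllipticCurves.SteinWuthrich2013
  Literature.NumberTheory.EllipticCurves.GreenbergVatsal2000
  Literature.NumberTheory.EllipticCurves.EmertonPollackWeston2006
  Literature.NumberTheory.EllipticCurves.BalakrishnanEtAl2019
  Summit.BirchSwinnertonDyer.Rank1Residual.X1.MuLambda
  Summit.BirchSwinnertonDyer.Rank1Residual.X11a.LambdaNorm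

set_option autoImplicit false

namespace Summit.BirchSwinnertonDyer.Rank1Residual.X11a

open Chain

/-- **X11a ∩ {`p ≥ 11`}: `BSD(E,p)` ⇐ NAMED PUBLISHED FACTS + the per-pair certificate
`μ^an(E,p) = 0`, with NO hypothesis on the image of `ρ̄_{E,p}`** — x11a's
`forall_bsdp_of_namedFacts` with its `Surj W p` binder supplied by
`ClassX11a.surj_of_eleven_le` (at a multiplicative `p ≥ 11`, `E[p]` irreducible ⟹ `ρ̄_{E,p}` onto;
one more named fact `hB` = BDMTV 2019 Thm. 1.2 / Bilu–Parent–Rebolledo 2013 Cor. 1.2).  No label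
change. [cite: BalakrishnanEtAl2019, §1 Thm. 1.2 (arXiv:1711.05846 p. 2)]
[cite: EmertonPollackWeston2006, Thm. 1, Thm. 3.1.1, Thm. 5.1.3, §3.1] [cite: Wan2015, Thm. 4]
[cite: SteinWuthrich2013, Thm. 6.1 (p. 20)] [cite: Wuthrich2014, Thm. 3 (p. 382) and Cor. 19 proof (p. 399)] -/
theorem forall_bsdp_of_namedFacts_of_eleven_le
    (hHida : hida_exists_congruent_ordinary_newform_of_multiplicative)
    (hMTT : exists_isCycPAdicLFunctionWeightK)
    (h311 : thm311_cotorsion_weightK_member) (hT1a : thm1_muAlg_of_weightK_member)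
    (hT2 : Wan2015.thm4_rational_weightK_member) (hT1b : thm513_transfer_from_weightK_member)
    (h61 : DeligneSerre1974.thm61_exists_adicGaloisRep) (h326 : Hida2000_thm326_ordinary)
    (hKato : kato_charIdeal_dvd_multiplicative_of_surjective)
    (hJs : thm61_splitMultiplicative) (hJn : thm61_nonsplitMultiplicative)
    (hHs : exists_isSplitMultCanonical) (hHn : exists_isMultCanonical)
    (hGZK : rank_eq_analyticRank_of_analyticRank_le_one) (hmod : hasEntireLFunction_rat)
    (hpar : nonempty_modularParametrizationData)
    (hGS : ∀ (W : WeierstrassCurve ℚ) [W.IsElliptic] [W.IsGloballyMinimal] (p : ℕ) [Fact p.Prime],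
      greenberg_stevens (W := W) (p := p))
    (hB : thm12_not_le_normalizer_splitCartan) :
    ∀ (W : WeierstrassCurve ℚ) [W.IsElliptic] [W.IsGloballyMinimal] (p : ℕ) [Fact p.Prime],
      ClassX11a W p → 11 ≤ p → MuAnZeroAt W p → BSDp W p := by
  intro W _ _ p _ hX h11 hμ
  exact forall_bsdp_of_namedFacts hHida hMTT h311 hT1a hT2 hT1b h61 h326 hKato hJs hJn hHs hHn hGZK
    hmod hpar hGS W p hX (by omega) (ClassX11a.surj_of_eleven_le W p hB hX h11) hμ

end Summit.BirchSwinnertonDyer.Rank1Residual.X11a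

end
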